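import Summits.HubbardSuperconductivity.HubbardSuperconductivity.Theorems.AnisotropyChordConcavityOneMagnonCoordinates
import Summits.HubbardSuperconductivity.HubbardSuperconductivity.Theorems.AnisotropyChordConcavityOneMagnonCertificates

/-!
# Route `AnisotropyChord`, support `Concavity` (stmt-HubbardSuperconductivity-8150): a NO-GO lemma —
# the condensate `Λ` of the XXZ sector ground state is NOT monotone (hence NOT concave) in the
# anisotropy `Δ` on a general connected graph (13-vertex two-hub witness, one-magnon sector)

HONEST FRAMING.  The route's items (`Concavity` stmt-8150, `ChordXY` stmt-8146, `ChordFM` stmt-8147,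
`FerroSideChord` stmt-19089) concern the HALF-FILLED sector of the square TORUS
`torusGraph 2 M`; nothing here refutes them.  What is proved: the same functional
`Λ(ψ) = Re⟨ψ, S⁺_tot S⁻_tot ψ⟩` of the sector ground state of `H(Δ) = xxzHamiltonian 1 G (−1) Δ`,
on the connected simple graph `W₁₃` = star `K_{1,8}` + clique `K₄` + one leaf–clique edge (13 sites)
in the one-magnon sector `S^z_tot = 11/2`, satisfies

  `Λ(ψ₁) ≥ 107/5 = 21.4`  for every normalised sector ground state at `Δ₁ = −7/40`, and
  `Λ(ψ₂) ≤ 777/40 = 19.425` for every normalised sector ground state at `Δ₂ = 3/8`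

(`condensate_ge_at_neg`, `condensate_le_at_pos`), so `Λ` DROPS as `Δ` increases across `0`
(`exists_connected_graph_condensate_dip`).  Consequences (`not_graphGeneral_monotone`,
`not_graphGeneral_concave`): the graph-general forms of "Λ of the sector ground state is
non-decreasing in `Δ ≤ 1`" (the transport principle `M_Δ` of the rotor-class S-bridge, theory seat
`hubbard-h0-rotor-theory-1`, = the fixed-magnetisation ground-state analogue of Dyson's HG2 problem) and
of the three-point concavity (CC) behind `Concavity` are FALSE; any proof of (CC)/`M_Δ` for the torus
must use the homogeneity (vertex-transitivity) of the torus, not only Perron–Frobenius, `su(2)` or a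
graph-blind variance-comparison identity.  Mechanism (theory seat, cycle 3): two weakly linked hubs
whose local Perron roots of `A − ΔD` cross inside `(−1, 1)` — the ground state switches hub and the
zero-momentum weight `(Σᵢvᵢ)²` overshoots.

Proof: graph-general one-magnon reduction (`…OneMagnonSector`, `…OneMagnonCoordinates`:
`H(Δ)|₁ = −½(A − ΔD) − Δ|E|/4`, `Λ = (Σa)² + (Σb)² + |V| − 2`), the variational principle with two
rational test vectors and two exact `LDLᵀ` certificates (`…OneMagnonCertificates`), then linear
arithmetic.  No Perron–Frobenius / uniqueness is needed: the bounds hold for EVERY ground state of the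
sector.  Numerics (theory seat): `Σv = 3.2470 → 2.6538`, `Λ = 21.54 → 18.04`.  No definition is
introduced; the witness graph is written in place as `SimpleGraph.fromRel …`.
-/

set_option linter.dupNamespace false

noncomputable section

namespace Summit.HubbardSuperconductivity.HubbardSuperconductivity.Theorems.AnisotropyChord.OneMagnon

open Matrix Complex Finset
open Literature.MathematicalPhysics.QuantumLattice

/-! ### The witness graph `W₁₃` (star `K_{1,8}` on `0;1…8`, clique on `9…12`, edge `8–9`) -/

/-- Degrees of `W₁₃`: `(8,1,1,1,1,1,1,1,2,4,3,3,3)`. [folklore] -/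
theorem witness_degree : ∀ i : Fin 13,
    (SimpleGraph.fromRel fun i j : Fin 13 =>
        (i.val = 0 ∧ 1 ≤ j.val ∧ j.val ≤ 8) ∨ (9 ≤ i.val ∧ 9 ≤ j.val) ∨ (i.val = 8 ∧ j.val = 9)).degree i =
      (![8, 1, 1, 1, 1, 1, 1, 1, 2, 4, 3, 3, 3] : Fin 13 → ℕ) i := by
  intro i
  rw [← SimpleGraph.card_neighborFinset_eq_degree, SimpleGraph.neighborFinset_eq_filter]
  revert i
  decide

/-- `W₁₃` has `15` edges (`Σ degrees = 30`). [folklore] -/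
theorem witness_card_edgeFinset :
    (SimpleGraph.fromRel fun i j : Fin 13 =>
        (i.val = 0 ∧ 1 ≤ j.val ∧ j.val ≤ 8) ∨ (9 ≤ i.val ∧ 9 ≤ j.val) ∨ (i.val = 8 ∧ j.val = 9)).edgeFinset.card = 15 := by
  have h := (SimpleGraph.fromRel fun i j : Fin 13 =>
        (i.val = 0 ∧ 1 ≤ j.val ∧ j.val ≤ 8) ∨ (9 ≤ i.val ∧ 9 ≤ j.val) ∨ (i.val = 8 ∧ j.val = 9)).sum_degrees_eq_twice_card_edges
  have hs : ∑ v, (SimpleGraph.fromRel fun i j : Fin 13 =>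
        (i.val = 0 ∧ 1 ≤ j.val ∧ j.val ≤ 8) ∨ (9 ≤ i.val ∧ 9 ≤ j.val) ∨ (i.val = 8 ∧ j.val = 9)).degree v = 30 := by
    simp [Fin.sum_univ_succ, witness_degree]
  omega

/-- `W₁₃` is connected (every vertex reaches the hub `0`). [folklore] -/
theorem witness_connected :
    (SimpleGraph.fromRel fun i j : Fin 13 =>
        (i.val = 0 ∧ 1 ≤ j.val ∧ j.val ≤ 8) ∨ (9 ≤ i.val ∧ 9 ≤ j.val) ∨ (i.val = 8 ∧ j.val = 9)).Connected := by
  refine @SimpleGraph.Connected.mk _ _ ?_ ⟨0⟩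
  have e : ∀ a b : Fin 13, (SimpleGraph.fromRel fun i j : Fin 13 =>
        (i.val = 0 ∧ 1 ≤ j.val ∧ j.val ≤ 8) ∨ (9 ≤ i.val ∧ 9 ≤ j.val) ∨ (i.val = 8 ∧ j.val = 9)).Adj a b →
      (SimpleGraph.fromRel fun i j : Fin 13 =>
        (i.val = 0 ∧ 1 ≤ j.val ∧ j.val ≤ 8) ∨ (9 ≤ i.val ∧ 9 ≤ j.val) ∨ (i.val = 8 ∧ j.val = 9)).Reachable a b := fun a b h => SimpleGraph.Adj.reachable h
  have h0 : ∀ u : Fin 13, (SimpleGraph.fromRel fun i j : Fin 13 =>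
        (i.val = 0 ∧ 1 ≤ j.val ∧ j.val ≤ 8) ∨ (9 ≤ i.val ∧ 9 ≤ j.val) ∨ (i.val = 8 ∧ j.val = 9)).Reachable 0 u := by
    intro u
    fin_cases u
    · exact SimpleGraph.Reachable.refl _
    · exact e 0 1 (by decide)
    · exact e 0 2 (by decide)
    · exact e 0 3 (by decide)
    · exact e 0 4 (by decide)
    · exact e 0 5 (by decide)
    · exact e 0 6 (by decide)
    · exact e 0 7 (by decide)
    · exact e 0 8 (by decide)
    · exact (e 0 8 (by decide)).trans (e 8 9 (by decide))
    · exact ((e 0 8 (by decide)).trans (e 8 9 (by decide))).trans (e 9 10 (by decide))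
    · exact ((e 0 8 (by decide)).trans (e 8 9 (by decide))).trans (e 9 11 (by decide))
    · exact ((e 0 8 (by decide)).trans (e 8 9 (by decide))).trans (e 9 12 (by decide))
  intro u v
  exact (h0 u).symm.trans (h0 v)

/-! ### Explicit quadratic forms on `W₁₃` -/

/-- Sums over `Fin 13`, written out. [folklore] -/
theorem sum13 (f : Fin 13 → ℝ) :
    ∑ i, f i = f 0 + f 1 + f 2 + f 3 + f 4 + f 5 + f 6 + f 7 + f 8 + f 9 + f 10 + f 11 + f 12 := by
  simp [Fin.sum_univ_succ]
  ring

/-- The one-magnon energy form of `W₁₃` for general site weights `q` and pair weights `p`: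
`|E| = 15`, degrees `(8,1,…,1,2,4,3,3,3)`, and the `30` ordered adjacent pairs. [folklore] -/
theorem witness_energyForm (Δ : ℝ) (q : Fin 13 → ℝ) (p : Fin 13 → Fin 13 → ℝ) :
    ∑ i, (-(Δ * ((((SimpleGraph.fromRel fun i j : Fin 13 =>
        (i.val = 0 ∧ 1 ≤ j.val ∧ j.val ≤ 8) ∨ (9 ≤ i.val ∧ 9 ≤ j.val) ∨ (i.val = 8 ∧ j.val = 9)).edgeFinset.card : ℕ) : ℝ) / 4 -
        (((SimpleGraph.fromRel fun i j : Fin 13 =>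
        (i.val = 0 ∧ 1 ≤ j.val ∧ j.val ≤ 8) ∨ (9 ≤ i.val ∧ 9 ≤ j.val) ∨ (i.val = 8 ∧ j.val = 9)).degree i : ℕ) : ℝ) / 2)) * q i
        - (1 / 2) * ∑ j, (if (SimpleGraph.fromRel fun i j : Fin 13 =>
        (i.val = 0 ∧ 1 ≤ j.val ∧ j.val ≤ 8) ∨ (9 ≤ i.val ∧ 9 ≤ j.val) ∨ (i.val = 8 ∧ j.val = 9)).Adj i j then p i j else 0))
      = -(Δ * 15 / 4) * (q 0 + q 1 + q 2 + q 3 + q 4 + q 5 + q 6 + q 7 + q 8 + q 9 + q 10 + q 11 + q 12) + (Δ / 2) * (8 * q 0 + q 1 + q 2 + q 3 + q 4 + q 5 + q 6 + q 7 + 2 * q 8 + 4 * q 9 + 3 * q 10 + 3 * q 11 + 3 * q 12)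
        - (1 / 2) * (p 0 1 + p 0 2 + p 0 3 + p 0 4 + p 0 5 + p 0 6 + p 0 7 + p 0 8 + p 1 0 + p 2 0 + p 3 0 + p 4 0 + p 5 0 + p 6 0 + p 7 0 + p 8 0 + p 8 9 + p 9 8 + p 9 10 + p 9 11 + p 9 12 + p 10 9 + p 10 11 + p 10 12 + p 11 9 + p 11 10 + p 11 12 + p 12 9 + p 12 10 + p 12 11) := by
  rw [witness_card_edgeFinset]
  simp [Fin.sum_univ_succ, SimpleGraph.fromRel_adj, witness_degree]
  ring

/-- The energy form on a pair of real amplitude vectors (real and imaginary parts). [folklore] -/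
theorem witness_energyForm_two (Δ : ℝ) (x y : Fin 13 → ℝ) :
    ∑ i, (-(Δ * ((((SimpleGraph.fromRel fun i j : Fin 13 =>
        (i.val = 0 ∧ 1 ≤ j.val ∧ j.val ≤ 8) ∨ (9 ≤ i.val ∧ 9 ≤ j.val) ∨ (i.val = 8 ∧ j.val = 9)).edgeFinset.card : ℕ) : ℝ) / 4 -
        (((SimpleGraph.fromRel fun i j : Fin 13 =>
        (i.val = 0 ∧ 1 ≤ j.val ∧ j.val ≤ 8) ∨ (9 ≤ i.val ∧ 9 ≤ j.val) ∨ (i.val = 8 ∧ j.val = 9)).degree i : ℕ) : ℝ) / 2)) * (x i ^ 2 + y i ^ 2)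
        - (1 / 2) * ∑ j, (if (SimpleGraph.fromRel fun i j : Fin 13 =>
        (i.val = 0 ∧ 1 ≤ j.val ∧ j.val ≤ 8) ∨ (9 ≤ i.val ∧ 9 ≤ j.val) ∨ (i.val = 8 ∧ j.val = 9)).Adj i j then x i * x j + y i * y j else 0))
      = -(1 / 2) * (2 * (x 0 * (x 1 + x 2 + x 3 + x 4 + x 5 + x 6 + x 7 + x 8) + x 8 * x 9 + x 9 * x 10 + x 9 * x 11 + x 9 * x 12 + x 10 * x 11 + x 10 * x 12 + x 11 * x 12)
            - Δ * (8 * x 0 ^ 2 + x 1 ^ 2 + x 2 ^ 2 + x 3 ^ 2 + x 4 ^ 2 + x 5 ^ 2 + x 6 ^ 2 + x 7 ^ 2 + 2 * x 8 ^ 2 + 4 * x 9 ^ 2 + 3 * x 10 ^ 2 + 3 * x 11 ^ 2 + 3 * x 12 ^ 2))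
        - (1 / 2) * (2 * (y 0 * (y 1 + y 2 + y 3 + y 4 + y 5 + y 6 + y 7 + y 8) + y 8 * y 9 + y 9 * y 10 + y 9 * y 11 + y 9 * y 12 + y 10 * y 11 + y 10 * y 12 + y 11 * y 12)
            - Δ * (8 * y 0 ^ 2 + y 1 ^ 2 + y 2 ^ 2 + y 3 ^ 2 + y 4 ^ 2 + y 5 ^ 2 + y 6 ^ 2 + y 7 ^ 2 + 2 * y 8 ^ 2 + 4 * y 9 ^ 2 + 3 * y 10 ^ 2 + 3 * y 11 ^ 2 + 3 * y 12 ^ 2))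
        - Δ * 15 / 4 * ((x 0 ^ 2 + x 1 ^ 2 + x 2 ^ 2 + x 3 ^ 2 + x 4 ^ 2 + x 5 ^ 2 + x 6 ^ 2 + x 7 ^ 2 + x 8 ^ 2 + x 9 ^ 2 + x 10 ^ 2 + x 11 ^ 2 + x 12 ^ 2)
            + (y 0 ^ 2 + y 1 ^ 2 + y 2 ^ 2 + y 3 ^ 2 + y 4 ^ 2 + y 5 ^ 2 + y 6 ^ 2 + y 7 ^ 2 + y 8 ^ 2 + y 9 ^ 2 + y 10 ^ 2 + y 11 ^ 2 + y 12 ^ 2)) := by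
  rw [witness_energyForm Δ (fun i => x i ^ 2 + y i ^ 2) (fun i j => x i * x j + y i * y j)]
  ring

/-- The energy form on one real amplitude vector (test vectors). [folklore] -/
theorem witness_energyForm_one (Δ : ℝ) (x : Fin 13 → ℝ) :
    ∑ i, (-(Δ * ((((SimpleGraph.fromRel fun i j : Fin 13 =>
        (i.val = 0 ∧ 1 ≤ j.val ∧ j.val ≤ 8) ∨ (9 ≤ i.val ∧ 9 ≤ j.val) ∨ (i.val = 8 ∧ j.val = 9)).edgeFinset.card : ℕ) : ℝ) / 4 -
        (((SimpleGraph.fromRel fun i j : Fin 13 =>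
        (i.val = 0 ∧ 1 ≤ j.val ∧ j.val ≤ 8) ∨ (9 ≤ i.val ∧ 9 ≤ j.val) ∨ (i.val = 8 ∧ j.val = 9)).degree i : ℕ) : ℝ) / 2)) * x i ^ 2
        - (1 / 2) * ∑ j, (if (SimpleGraph.fromRel fun i j : Fin 13 =>
        (i.val = 0 ∧ 1 ≤ j.val ∧ j.val ≤ 8) ∨ (9 ≤ i.val ∧ 9 ≤ j.val) ∨ (i.val = 8 ∧ j.val = 9)).Adj i j then x i * x j else 0))
      = -(1 / 2) * (2 * (x 0 * (x 1 + x 2 + x 3 + x 4 + x 5 + x 6 + x 7 + x 8) + x 8 * x 9 + x 9 * x 10 + x 9 * x 11 + x 9 * x 12 + x 10 * x 11 + x 10 * x 12 + x 11 * x 12)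
            - Δ * (8 * x 0 ^ 2 + x 1 ^ 2 + x 2 ^ 2 + x 3 ^ 2 + x 4 ^ 2 + x 5 ^ 2 + x 6 ^ 2 + x 7 ^ 2 + 2 * x 8 ^ 2 + 4 * x 9 ^ 2 + 3 * x 10 ^ 2 + 3 * x 11 ^ 2 + 3 * x 12 ^ 2))
        - Δ * 15 / 4 * (x 0 ^ 2 + x 1 ^ 2 + x 2 ^ 2 + x 3 ^ 2 + x 4 ^ 2 + x 5 ^ 2 + x 6 ^ 2 + x 7 ^ 2 + x 8 ^ 2 + x 9 ^ 2 + x 10 ^ 2 + x 11 ^ 2 + x 12 ^ 2) := by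
  rw [witness_energyForm Δ (fun i => x i ^ 2) (fun i j => x i * x j)]
  ring

/-! ### The two bounds -/

/-- **Lower bound at `Δ₁ = −7/40`.** Every normalised ground state of the one-magnon sector
`S^z_tot = 11/2` of `H(−7/40)` on `W₁₃` has condensate `Λ(ψ) ≥ 107/5 = 21.4`
(variational principle with a rational test vector + certificate 1: `(Σa)² + (Σb)² ≥ 10.4`).
[folklore] -/
theorem condensate_ge_at_neg (ψ : TensorIndex (Fin 13) 2 → ℂ)
    (hmem : ψ ∈ spinZSector (Λ := Fin 13) 1 (11 / 2)) (hnorm : star ψ ⬝ᵥ ψ = 1)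
    (heig : xxzHamiltonian 1 (SimpleGraph.fromRel fun i j : Fin 13 =>
        (i.val = 0 ∧ 1 ≤ j.val ∧ j.val ≤ 8) ∨ (9 ≤ i.val ∧ 9 ≤ j.val) ∨ (i.val = 8 ∧ j.val = 9)) (-1) (-7 / 40) *ᵥ ψ =
      ((lowestEnergyInSector 1 (xxzHamiltonian 1 (SimpleGraph.fromRel fun i j : Fin 13 =>
        (i.val = 0 ∧ 1 ≤ j.val ∧ j.val ≤ 8) ∨ (9 ≤ i.val ∧ 9 ≤ j.val) ∨ (i.val = 8 ∧ j.val = 9)) (-1) (-7 / 40)) (11 / 2) : ℝ) : ℂ) • ψ) :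
    (107 / 5 : ℝ) ≤ (star ψ ⬝ᵥ (((∑ x, onSite x (spinRaise 1)) * (∑ y, onSite y (spinLower 1)) : Op (Fin 13) 2) *ᵥ ψ)).re := by
  have hlab : (11 / 2 : ℝ) = (Fintype.card (Fin 13) : ℝ) / 2 - 1 := by norm_num
  rw [hlab] at hmem heig
  have hsupp := apply_eq_zero_of_mem_oneMagnonSector hmem
  -- energy of the ground state in coordinates
  have hE := re_energy_of_eigen hnorm heig
  rw [re_energy_eq _ (-7 / 40) hsupp,
    witness_energyForm_two (-7 / 40) (fun i => (ψ (Pi.single i 1)).re) (fun i => (ψ (Pi.single i 1)).im)] at hE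
  -- norm in coordinates
  have hN : (star ψ ⬝ᵥ ψ).re = 1 := by rw [hnorm, Complex.one_re]
  have hN' := hN
  rw [re_norm_eq hsupp, sum13] at hN'
  -- variational principle with the rational test vector
  have hV := energy_le_test (SimpleGraph.fromRel fun i j : Fin 13 =>
        (i.val = 0 ∧ 1 ≤ j.val ∧ j.val ≤ 8) ∨ (9 ≤ i.val ∧ 9 ≤ j.val) ∨ (i.val = 8 ∧ j.val = 9)) (-7 / 40)
    ![57125/96891, 5250/32297, 5250/32297, 5250/32297, 5250/32297, 5250/32297, 5250/32297, 5250/32297, 9000/32297, 35875/96891, 9375/32297, 9375/32297, 28109/96891]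
  rw [witness_energyForm_one, sum13] at hV
  obtain ⟨hy1, hy2⟩ := test_lower_one _ rfl
  rw [hy1, mul_one] at hV
  -- certificates for the real and imaginary parts
  have c1 := cert_upper_one (fun i => (ψ (Pi.single i 1)).re)
  have c2 := cert_upper_one (fun i => (ψ (Pi.single i 1)).im)
  -- condensate in coordinates
  rw [condensate_eq hmem, hN, sum13, sum13]
  simp only [Fintype.card_fin, Nat.cast_ofNat] at hE hV ⊢
  linarith

/-- **Upper bound at `Δ₂ = 3/8`.** Every normalised ground state of the one-magnon sector
`S^z_tot = 11/2` of `H(3/8)` on `W₁₃` has condensate `Λ(ψ) ≤ 777/40 = 19.425`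
(variational principle with a rational test vector + certificate 2: `(Σa)² + (Σb)² ≤ 8.425`).
[folklore] -/
theorem condensate_le_at_pos (ψ : TensorIndex (Fin 13) 2 → ℂ)
    (hmem : ψ ∈ spinZSector (Λ := Fin 13) 1 (11 / 2)) (hnorm : star ψ ⬝ᵥ ψ = 1)
    (heig : xxzHamiltonian 1 (SimpleGraph.fromRel fun i j : Fin 13 =>
        (i.val = 0 ∧ 1 ≤ j.val ∧ j.val ≤ 8) ∨ (9 ≤ i.val ∧ 9 ≤ j.val) ∨ (i.val = 8 ∧ j.val = 9)) (-1) (3 / 8) *ᵥ ψ =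
      ((lowestEnergyInSector 1 (xxzHamiltonian 1 (SimpleGraph.fromRel fun i j : Fin 13 =>
        (i.val = 0 ∧ 1 ≤ j.val ∧ j.val ≤ 8) ∨ (9 ≤ i.val ∧ 9 ≤ j.val) ∨ (i.val = 8 ∧ j.val = 9)) (-1) (3 / 8)) (11 / 2) : ℝ) : ℂ) • ψ) :
    (star ψ ⬝ᵥ (((∑ x, onSite x (spinRaise 1)) * (∑ y, onSite y (spinLower 1)) : Op (Fin 13) 2) *ᵥ ψ)).re ≤ (777 / 40 : ℝ) := by
  have hlab : (11 / 2 : ℝ) = (Fintype.card (Fin 13) : ℝ) / 2 - 1 := by norm_num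
  rw [hlab] at hmem heig
  have hsupp := apply_eq_zero_of_mem_oneMagnonSector hmem
  have hE := re_energy_of_eigen hnorm heig
  rw [re_energy_eq _ (3 / 8) hsupp,
    witness_energyForm_two (3 / 8) (fun i => (ψ (Pi.single i 1)).re) (fun i => (ψ (Pi.single i 1)).im)] at hE
  have hN : (star ψ ⬝ᵥ ψ).re = 1 := by rw [hnorm, Complex.one_re]
  have hN' := hN
  rw [re_norm_eq hsupp, sum13] at hN'
  have hV := energy_le_test (SimpleGraph.fromRel fun i j : Fin 13 =>
        (i.val = 0 ∧ 1 ≤ j.val ∧ j.val ≤ 8) ∨ (9 ≤ i.val ∧ 9 ≤ j.val) ∨ (i.val = 8 ∧ j.val = 9)) (3 / 8)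
    ![34400/271427, 15200/271427, 15200/271427, 15200/271427, 15200/271427, 15200/271427, 15200/271427, 15200/271427, 62800/271427, 132000/271427, 128400/271427, 128400/271427, 128573/271427]
  rw [witness_energyForm_one, sum13] at hV
  obtain ⟨hy1, hy2⟩ := test_lower_two _ rfl
  rw [hy1, mul_one] at hV
  have c1 := cert_upper_two (fun i => (ψ (Pi.single i 1)).re)
  have c2 := cert_upper_two (fun i => (ψ (Pi.single i 1)).im)
  rw [condensate_eq hmem, hN, sum13, sum13]
  simp only [Fintype.card_fin, Nat.cast_ofNat] at hE hV ⊢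
  linarith

/-! ### Corollaries: the dip, and the failure of graph-general monotonicity -/

/-- **The dip (existential form).**  There is a connected simple graph on `13` sites — the two-hub
graph `W₁₃` — such that, in the one-magnon sector `S^z_tot = 11/2`, EVERY normalised ground state of
`H(−7/40)` has condensate larger by at least `79/40` than EVERY normalised ground state of `H(3/8)`:
`Λ` drops as the anisotropy increases from `−7/40` to `3/8` (both in `[−1, 1]`).  Stated for every
decidability instance of the adjacency relation (the Hamiltonian does not depend on it). [folklore] -/
theorem exists_connected_graph_condensate_dip :
    ∃ G : SimpleGraph (Fin 13), G.Connected ∧ ∀ [DecidableRel G.Adj] (ψ₁ ψ₂ : TensorIndex (Fin 13) 2 → ℂ),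
      ψ₁ ∈ spinZSector (Λ := Fin 13) 1 (11 / 2) → star ψ₁ ⬝ᵥ ψ₁ = 1 →
      xxzHamiltonian 1 G (-1) (-7 / 40) *ᵥ ψ₁ =
        ((lowestEnergyInSector 1 (xxzHamiltonian 1 G (-1) (-7 / 40)) (11 / 2) : ℝ) : ℂ) • ψ₁ →
      ψ₂ ∈ spinZSector (Λ := Fin 13) 1 (11 / 2) → star ψ₂ ⬝ᵥ ψ₂ = 1 →
      xxzHamiltonian 1 G (-1) (3 / 8) *ᵥ ψ₂ =
        ((lowestEnergyInSector 1 (xxzHamiltonian 1 G (-1) (3 / 8)) (11 / 2) : ℝ) : ℂ) • ψ₂ →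
      (star ψ₂ ⬝ᵥ (((∑ x, onSite x (spinRaise 1)) * (∑ y, onSite y (spinLower 1)) : Op (Fin 13) 2) *ᵥ ψ₂)).re + 79 / 40
        ≤ (star ψ₁ ⬝ᵥ (((∑ x, onSite x (spinRaise 1)) * (∑ y, onSite y (spinLower 1)) : Op (Fin 13) 2) *ᵥ ψ₁)).re := by
  refine ⟨(SimpleGraph.fromRel fun i j : Fin 13 =>
        (i.val = 0 ∧ 1 ≤ j.val ∧ j.val ≤ 8) ∨ (9 ≤ i.val ∧ 9 ≤ j.val) ∨ (i.val = 8 ∧ j.val = 9)), witness_connected, ?_⟩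
  intro inst ψ₁ ψ₂ h1m h1n h1e h2m h2n h2e
  have k1 := condensate_ge_at_neg ψ₁ h1m h1n (by convert h1e)
  have k2 := condensate_le_at_pos ψ₂ h2m h2n (by convert h2e)
  linarith

/-- **Graph-general monotonicity of the condensate in the anisotropy is FALSE.**  The statement
"for every finite connected simple graph, every magnetisation sector and all `−1 ≤ Δ₁ ≤ Δ₂ ≤ 1`, the
condensate `Λ = Re⟨ψ, S⁺_tot S⁻_tot ψ⟩` of normalised sector ground states of
`xxzHamiltonian 1 G (−1) Δ` is non-decreasing from `Δ₁` to `Δ₂`" (the graph-general form of the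
monotone-transport principle `M_Δ`; on the torus it would carry the KLS order at `Δ = 0` to the
attractive side) fails on `W₁₃` in the one-magnon sector between `Δ₁ = −7/40` and `Δ₂ = 3/8`.
Hence any proof of `M_Δ` — or of the concavity (CC) behind `Concavity` (stmt-8150), which together
with the ferromagnetic ceiling implies `M_Δ` — must use the homogeneity of the torus. [folklore] -/
theorem not_graphGeneral_condensate_monotone :
    ¬ (∀ (V : Type) [Fintype V] [DecidableEq V] (G : SimpleGraph V) [DecidableRel G.Adj],
        G.Connected → ∀ (M Δ₁ Δ₂ : ℝ), -1 ≤ Δ₁ → Δ₁ ≤ Δ₂ → Δ₂ ≤ 1 →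
        ∀ ψ₁ ψ₂ : TensorIndex V 2 → ℂ,
          ψ₁ ∈ spinZSector (Λ := V) 1 M → star ψ₁ ⬝ᵥ ψ₁ = 1 →
          xxzHamiltonian 1 G (-1) Δ₁ *ᵥ ψ₁ =
            ((lowestEnergyInSector 1 (xxzHamiltonian 1 G (-1) Δ₁) M : ℝ) : ℂ) • ψ₁ →
          ψ₂ ∈ spinZSector (Λ := V) 1 M → star ψ₂ ⬝ᵥ ψ₂ = 1 →
          xxzHamiltonian 1 G (-1) Δ₂ *ᵥ ψ₂ =
            ((lowestEnergyInSector 1 (xxzHamiltonian 1 G (-1) Δ₂) M : ℝ) : ℂ) • ψ₂ →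
          (star ψ₁ ⬝ᵥ (((∑ x, onSite x (spinRaise 1)) * (∑ y, onSite y (spinLower 1)) : Op V 2) *ᵥ ψ₁)).re
            ≤ (star ψ₂ ⬝ᵥ (((∑ x, onSite x (spinRaise 1)) * (∑ y, onSite y (spinLower 1)) : Op V 2) *ᵥ ψ₂)).re) := by
  intro h
  have hlab : ((Fintype.card (Fin 13) : ℝ) / 2 - 1) = 11 / 2 := by norm_num
  obtain ⟨ψ₁, h1m, h1n, h1e⟩ := exists_oneMagnon_groundState (SimpleGraph.fromRel fun i j : Fin 13 =>
        (i.val = 0 ∧ 1 ≤ j.val ∧ j.val ≤ 8) ∨ (9 ≤ i.val ∧ 9 ≤ j.val) ∨ (i.val = 8 ∧ j.val = 9)) (-7 / 40)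
  obtain ⟨ψ₂, h2m, h2n, h2e⟩ := exists_oneMagnon_groundState (SimpleGraph.fromRel fun i j : Fin 13 =>
        (i.val = 0 ∧ 1 ≤ j.val ∧ j.val ≤ 8) ∨ (9 ≤ i.val ∧ 9 ≤ j.val) ∨ (i.val = 8 ∧ j.val = 9)) (3 / 8)
  rw [hlab] at h1m h1e h2m h2e
  have hmono := h (Fin 13) (SimpleGraph.fromRel fun i j : Fin 13 =>
        (i.val = 0 ∧ 1 ≤ j.val ∧ j.val ≤ 8) ∨ (9 ≤ i.val ∧ 9 ≤ j.val) ∨ (i.val = 8 ∧ j.val = 9)) witness_connected (11 / 2) (-7 / 40) (3 / 8)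
    (by norm_num) (by norm_num) (by norm_num) ψ₁ ψ₂ h1m h1n h1e h2m h2n h2e
  have k1 := condensate_ge_at_neg ψ₁ h1m h1n h1e
  have k2 := condensate_le_at_pos ψ₂ h2m h2n h2e
  linarith

/-- The same failure for the **total spin** `⟨𝐒²_tot⟩` (the Casimir form of `M_Δ`, i.e. the
fixed-magnetisation ground-state analogue of Dyson's HG2 monotonicity): on a sector,
`Re⟨ψ, 𝐒²ψ⟩ = Λ(ψ) + (M² − M)‖ψ‖²`, so `⟨𝐒²_tot⟩` of the sector ground state of `W₁₃` also drops from
`Δ = −7/40` to `Δ = 3/8`. [folklore] -/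
theorem not_graphGeneral_totalSpinSq_monotone :
    ¬ (∀ (V : Type) [Fintype V] [DecidableEq V] (G : SimpleGraph V) [DecidableRel G.Adj],
        G.Connected → ∀ (M Δ₁ Δ₂ : ℝ), -1 ≤ Δ₁ → Δ₁ ≤ Δ₂ → Δ₂ ≤ 1 →
        ∀ ψ₁ ψ₂ : TensorIndex V 2 → ℂ,
          ψ₁ ∈ spinZSector (Λ := V) 1 M → star ψ₁ ⬝ᵥ ψ₁ = 1 →
          xxzHamiltonian 1 G (-1) Δ₁ *ᵥ ψ₁ =
            ((lowestEnergyInSector 1 (xxzHamiltonian 1 G (-1) Δ₁) M : ℝ) : ℂ) • ψ₁ →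
          ψ₂ ∈ spinZSector (Λ := V) 1 M → star ψ₂ ⬝ᵥ ψ₂ = 1 →
          xxzHamiltonian 1 G (-1) Δ₂ *ᵥ ψ₂ =
            ((lowestEnergyInSector 1 (xxzHamiltonian 1 G (-1) Δ₂) M : ℝ) : ℂ) • ψ₂ →
          (star ψ₁ ⬝ᵥ ((totalSpinSq 1 : Op V 2) *ᵥ ψ₁)).re
            ≤ (star ψ₂ ⬝ᵥ ((totalSpinSq 1 : Op V 2) *ᵥ ψ₂)).re) := by
  intro h
  have hlab : ((Fintype.card (Fin 13) : ℝ) / 2 - 1) = 11 / 2 := by norm_num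
  obtain ⟨ψ₁, h1m, h1n, h1e⟩ := exists_oneMagnon_groundState (SimpleGraph.fromRel fun i j : Fin 13 =>
        (i.val = 0 ∧ 1 ≤ j.val ∧ j.val ≤ 8) ∨ (9 ≤ i.val ∧ 9 ≤ j.val) ∨ (i.val = 8 ∧ j.val = 9)) (-7 / 40)
  obtain ⟨ψ₂, h2m, h2n, h2e⟩ := exists_oneMagnon_groundState (SimpleGraph.fromRel fun i j : Fin 13 =>
        (i.val = 0 ∧ 1 ≤ j.val ∧ j.val ≤ 8) ∨ (9 ≤ i.val ∧ 9 ≤ j.val) ∨ (i.val = 8 ∧ j.val = 9)) (3 / 8)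
  rw [hlab] at h1m h1e h2m h2e
  have hmono := h (Fin 13) (SimpleGraph.fromRel fun i j : Fin 13 =>
        (i.val = 0 ∧ 1 ≤ j.val ∧ j.val ≤ 8) ∨ (9 ≤ i.val ∧ 9 ≤ j.val) ∨ (i.val = 8 ∧ j.val = 9)) witness_connected (11 / 2) (-7 / 40) (3 / 8)
    (by norm_num) (by norm_num) (by norm_num) ψ₁ ψ₂ h1m h1n h1e h2m h2n h2e
  rw [re_totalSpinSq_eq_condensate_add h1m, re_totalSpinSq_eq_condensate_add h2m, h1n, h2n] at hmono
  have k1 := condensate_ge_at_neg ψ₁ h1m h1n h1e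
  have k2 := condensate_le_at_pos ψ₂ h2m h2n h2e
  simp only [Complex.one_re, mul_one] at hmono
  linarith

end Summit.HubbardSuperconductivity.HubbardSuperconductivity.Theorems.AnisotropyChord.OneMagnon
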